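import Summits.CriticalPhenomena.CardyFormulaZ2.Theses.CardyDiscreteHolo

/-!
# `BondSumRule` — birth skeleton (BC3), crux `stmt-CriticalPhenomena-8934`
of `route-CriticalPhenomena-CardyDiscreteHolo` (sub-problem `CardyFormulaZ2`).

Crux (fixed, the route's decl, not restated):
`BondSumRule : ∀ T : MarkedDomain 3, TendstoLocallyUniformlyOn (fun δ z ↦ H^δ_0 z + H^δ_1 z + H^δ_2 z)
  (fun _ ↦ 1) (𝓝[>] 0) T.carrier`, `H^δ_α = bondSeparatingProb T α δ`.

Line ("a priori regularity + pointwise identity", the Bollobás–Riordan Claim 22 / Claim 24 cut of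
Smirnov's argument, transplanted to bond-`ℤ²`):

* `stub_apriori` — RSW a priori regularity (interior form of B–R Claim 22 for the separating
  probabilities): on every compact `K ⊆ Ω` the functions `z ↦ H^δ_α(z)` are asymptotically
  equicontinuous, uniformly in small `δ`. Its signature IS the route's support item
  `CardyDiscreteHoloR4HolderApriori` (stmt-CriticalPhenomena-0711) BY NAME, so the proof of that
  item closes the stub (unfolded text: `sig_stub_apriori_unfold`). Mechanism: `E_α(z) Δ E_α(w)` forces an open crossing of `Ω_δ`
  between the two arcs adjacent to `pt α` to meet the `η`-neighbourhood of `z`, i.e. an open arm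
  from `B(z, η)` to distance `dist(K, ∂Ω)/2`, whose `P_{1/2}`-probability is `≤ C (η / d)^c`
  uniformly in `δ ≤ η` by RSW on bond-`ℤ²` (`rsw_half`) — size M/L.
* `stub_pointwise : Sig.stub_pointwise` — the pointwise sum rule: for every `z ∈ Ω`, `Σ_α H^δ_α(z) → 1` as `δ → 0⁺`.
  This carries the open content of the crux (the expected number `E[N_δ(z)]` of corners `α` whose
  outermost open crossing passes beyond `z` tends to `1`); it is strictly weaker than the crux
  (no uniformity) and is the form a Monte-Carlo run or an exact identity attacks.
* `BondSumRule_of` — the kernel-checked composition: pointwise convergence + asymptotic local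
  equicontinuity ⇒ locally uniform convergence (ε/2 + 3·ε/6 on a closed ball inside the open
  carrier). No Arzelà–Ascoli is needed because the limit is the constant `1`.

Disproof used: none on file (`ledger crux ls stmt-CriticalPhenomena-8934`: no `Disproof.lean`,
no `Negative/` lemma; `ledger negatives --problem CriticalPhenomena`: 11 entries, none about
`bondSeparatingProb`).
-/

namespace Summit.CriticalPhenomena.CardyFormulaZ2.Cruxes.BondSumRule.Birth

open Filter Set Metric Topology
open Literature.Probability.Percolation Literature.Probability.RandomPlanarGeometry
open Summit.CriticalPhenomena.CardyFormulaZ2.Theses.CardyDiscreteHolo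

/-! ### Stub signatures (named `Prop`s, so that `BondSumRule_of` takes its hypotheses BY NAME) -/

/-- Signature of `stub_pointwise` — the **pointwise sum rule**: for every conformal triangle `T`
and every `z ∈ Ω`, `H^δ_0(z) + H^δ_1(z) + H^δ_2(z) → 1` as `δ → 0⁺`. -/
def Sig.stub_pointwise : Prop :=
  ∀ (T : Literature.Probability.RandomPlanarGeometry.MarkedDomain 3), ∀ z ∈ T.carrier,
    Filter.Tendsto
      (fun δ => Literature.Probability.Percolation.bondSeparatingProb T 0 δ z +
        Literature.Probability.Percolation.bondSeparatingProb T 1 δ z +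
        Literature.Probability.Percolation.bondSeparatingProb T 2 δ z)
      (nhdsWithin 0 (Set.Ioi 0)) (nhds 1)

/-- The signature of `stub_apriori` is the route's support item `CardyDiscreteHoloR4HolderApriori`
(stmt-CriticalPhenomena-0711) BY NAME; unfolded it reads as follows (checked by `Iff.rfl`). -/
theorem sig_stub_apriori_unfold :
    CardyDiscreteHoloR4HolderApriori ↔
    (∀ (T : Literature.Probability.RandomPlanarGeometry.MarkedDomain 3) (α : Fin 3) (K : Set ℂ),
      IsCompact K → K ⊆ T.carrier → ∀ β > (0 : ℝ), ∃ η > (0 : ℝ), ∃ δ₁ > (0 : ℝ),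
        ∀ δ ∈ Set.Ioo 0 δ₁, ∀ z ∈ K, ∀ w ∈ K, dist z w < η →
          dist (Literature.Probability.Percolation.bondSeparatingProb T α δ z)
            (Literature.Probability.Percolation.bondSeparatingProb T α δ w) < β) :=
  Iff.rfl

/-! ### The stubs -/

/-- **Stub 1 (a priori regularity, RSW) = the route item `CardyDiscreteHoloR4HolderApriori`
(stmt-CriticalPhenomena-0711) by name.** Interior asymptotic equicontinuity of each `H^δ_α` on
compacts `K ⊆ Ω`, uniformly in small `δ` (interior form of Bollobás–Riordan Claim 22; one open arm
from `B(z, η)` to distance `dist(K, ∂Ω)/2`, RSW on bond-`ℤ²`). Size M/L. -/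
theorem stub_apriori : CardyDiscreteHoloR4HolderApriori := by
  sorry

/-- **Stub 2 (pointwise sum rule; the open core of the crux).** -/
theorem stub_pointwise : Sig.stub_pointwise := by
  sorry

/-! ### The composition (complete proof): the two stubs give the crux BY NAME -/

/-- **`BondSumRule` from the two stubs.** A priori local equicontinuity + pointwise sum rule ⇒
locally uniform sum rule, by an `ε/2 + 3·(ε/6)` argument on a closed ball inside the open
carrier (no Arzelà–Ascoli: the limit is the constant `1`). -/
theorem BondSumRule_of :
    CardyDiscreteHoloR4HolderApriori → Sig.stub_pointwise →
      Summit.CriticalPhenomena.CardyFormulaZ2.Theses.CardyDiscreteHolo.BondSumRule := by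
  intro hA hP T
  dsimp only [CardyDiscreteHoloR4HolderApriori] at hA
  dsimp only [Sig.stub_pointwise] at hP
  rw [Metric.tendstoLocallyUniformlyOn_iff]
  intro ε hε x hx
  -- a closed ball around `x` inside the (open) carrier
  obtain ⟨r, hr, hrsub⟩ : ∃ r > 0, closedBall x r ⊆ T.carrier :=
    Metric.nhds_basis_closedBall.mem_iff.1 (T.isOpen.mem_nhds hx)
  have hK : IsCompact (closedBall x r) := isCompact_closedBall x r
  have hε6 : (0 : ℝ) < ε / 6 := by positivity
  obtain ⟨η₀, hη₀, δ₀, hδ₀, h₀⟩ := hA T 0 (closedBall x r) hK hrsub (ε / 6) hε6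
  obtain ⟨η₁, hη₁, δ₁, hδ₁, h₁⟩ := hA T 1 (closedBall x r) hK hrsub (ε / 6) hε6
  obtain ⟨η₂, hη₂, δ₂, hδ₂, h₂⟩ := hA T 2 (closedBall x r) hK hrsub (ε / 6) hε6
  set ρ : ℝ := min r (min η₀ (min η₁ η₂)) with hρ_def
  have hρ : 0 < ρ := lt_min hr (lt_min hη₀ (lt_min hη₁ hη₂))
  refine ⟨ball x ρ, mem_nhdsWithin_of_mem_nhds (ball_mem_nhds x hρ), ?_⟩
  have hevδ : ∀ᶠ δ in 𝓝[>] (0 : ℝ), δ ∈ Ioo 0 (min δ₀ (min δ₁ δ₂)) :=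
    Ioo_mem_nhdsGT (lt_min hδ₀ (lt_min hδ₁ hδ₂))
  have hevx : ∀ᶠ δ in 𝓝[>] (0 : ℝ),
      dist (bondSeparatingProb T 0 δ x + bondSeparatingProb T 1 δ x + bondSeparatingProb T 2 δ x)
        1 < ε / 2 :=
    Metric.tendsto_nhds.1 (hP T x hx) (ε / 2) (by positivity)
  filter_upwards [hevδ, hevx] with δ hδ hδx y hy
  have hxK : x ∈ closedBall x r := mem_closedBall_self hr.le
  have hyρ : dist y x < ρ := mem_ball.1 hy
  have hyK : y ∈ closedBall x r := mem_closedBall.2 (hyρ.le.trans (min_le_left _ _))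
  have hxy : dist x y < ρ := by rwa [dist_comm]
  have hd₀ : dist x y < η₀ := hxy.trans_le ((min_le_right _ _).trans (min_le_left _ _))
  have hd₁ : dist x y < η₁ :=
    hxy.trans_le ((min_le_right _ _).trans ((min_le_right _ _).trans (min_le_left _ _)))
  have hd₂ : dist x y < η₂ :=
    hxy.trans_le ((min_le_right _ _).trans ((min_le_right _ _).trans (min_le_right _ _)))
  have hδ₀' : δ ∈ Ioo 0 δ₀ := ⟨hδ.1, hδ.2.trans_le (min_le_left _ _)⟩
  have hδ₁' : δ ∈ Ioo 0 δ₁ := ⟨hδ.1, hδ.2.trans_le ((min_le_right _ _).trans (min_le_left _ _))⟩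
  have hδ₂' : δ ∈ Ioo 0 δ₂ := ⟨hδ.1, hδ.2.trans_le ((min_le_right _ _).trans (min_le_right _ _))⟩
  have e₀ := h₀ δ hδ₀' x hxK y hyK hd₀
  have e₁ := h₁ δ hδ₁' x hxK y hyK hd₁
  have e₂ := h₂ δ hδ₂' x hxK y hyK hd₂
  have hsum : dist (bondSeparatingProb T 0 δ x + bondSeparatingProb T 1 δ x + bondSeparatingProb T 2 δ x)
      (bondSeparatingProb T 0 δ y + bondSeparatingProb T 1 δ y + bondSeparatingProb T 2 δ y)
        < ε / 2 := by
    calc dist (bondSeparatingProb T 0 δ x + bondSeparatingProb T 1 δ x + bondSeparatingProb T 2 δ x)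
          (bondSeparatingProb T 0 δ y + bondSeparatingProb T 1 δ y + bondSeparatingProb T 2 δ y)
        ≤ dist (bondSeparatingProb T 0 δ x + bondSeparatingProb T 1 δ x)
            (bondSeparatingProb T 0 δ y + bondSeparatingProb T 1 δ y) +
          dist (bondSeparatingProb T 2 δ x) (bondSeparatingProb T 2 δ y) := dist_add_add_le _ _ _ _
      _ ≤ (dist (bondSeparatingProb T 0 δ x) (bondSeparatingProb T 0 δ y) +
            dist (bondSeparatingProb T 1 δ x) (bondSeparatingProb T 1 δ y)) +
          dist (bondSeparatingProb T 2 δ x) (bondSeparatingProb T 2 δ y) :=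
          add_le_add (dist_add_add_le _ _ _ _) le_rfl
      _ < (ε / 6 + ε / 6) + ε / 6 := by gcongr
      _ = ε / 2 := by ring
  show dist (1 : ℝ)
      (bondSeparatingProb T 0 δ y + bondSeparatingProb T 1 δ y + bondSeparatingProb T 2 δ y) < ε
  calc dist (1 : ℝ)
        (bondSeparatingProb T 0 δ y + bondSeparatingProb T 1 δ y + bondSeparatingProb T 2 δ y)
      ≤ dist (1 : ℝ)
          (bondSeparatingProb T 0 δ x + bondSeparatingProb T 1 δ x + bondSeparatingProb T 2 δ x) +
        dist (bondSeparatingProb T 0 δ x + bondSeparatingProb T 1 δ x + bondSeparatingProb T 2 δ x)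
          (bondSeparatingProb T 0 δ y + bondSeparatingProb T 1 δ y + bondSeparatingProb T 2 δ y) :=
        dist_triangle _ _ _
    _ < ε / 2 + ε / 2 := by
        gcongr
        rwa [dist_comm]
    _ = ε := by ring

end Summit.CriticalPhenomena.CardyFormulaZ2.Cruxes.BondSumRule.Birth
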